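import Mathlib
import HarnessLib
import Summits.Ventures.LatticeQCDFlow.Scoring.SimultaneousAgreement
import Summits.Ventures.LatticeQCDFlow.Exactness.NCMCGeneralSpaceReplicaTStatisticCoverage

/-!
# Several replica-`t` bars at once: `k` bars with limiting coverages `L_R(q_j)` hold SIMULTANEOUSLY with probability eventually `≥ 1 − Σ_j (1 − L_R(q_j)) − ε` — no independence between the observables

HONEST FRAMING: exact (Metropolis-corrected) sampling algorithms for lattice gauge theory;
figures of merit are autocorrelation/cost numbers at stated couplings and volumes; no
continuum-physics claim.

Venture `LatticeQCDFlow` (cell pub-lqcd), topic `Exactness`; FANOUT row 13 (`eng-snf`, GEN-24).  NEW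
WORK of the cell — the composition of row 4's asymptotic Bonferroni inequality
(`Scoring.CardConsistency.eventually_measureReal_biInter_ge`, `Scoring/SimultaneousAgreement`) with
GEN-23 K3's replica-`t` coverage theorem
(`tendsto_measure_abs_tStat_le_of_pi_gaussianReal`, `pi_gaussianReal_measure_abs_tStat_le_eq`).
No definition; nothing cited as a fact (Bonferroni NAMED ONLY).

WHY (row 13).  One engine run prints several replica / jackknife bars at once (the free-energy
estimate, acceptance rates, plaquette-type observables), all computed from the SAME `R` replicas, so
the bars are dependent in an unknown way.  Each bar separately has the universal limiting coverage
`L_R(q_j)` (GEN-23/24).  The table-level statement needs no joint limit: by Bonferroni, for every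
`ε > 0`, eventually all `k` bars cover simultaneously with probability at least
`1 − Σ_j (1 − L_R(q_j)) − ε`; reading each bar at per-bar level `L_R(q_j) = 1 − α/k` makes the whole
table simultaneously valid with asymptotic probability `≥ 1 − α − ε`.

## Content
* `tendsto_measureReal_of_tendsto_measure` (§1) — `P(Eₙ) → c` in `ℝ≥0∞` (finite measure) gives
  `P.real(Eₙ) → c.toReal`.
* `measurableSet_abs_tStat_le` (§1) — the acceptance event of a replica-`t` bar is measurable.
* **`eventually_measureReal_biInter_abs_tStat_le_ge`** (§2) — finitely many replica-vector
  statistics `V^j_n : Ω → EuclideanSpace ℝ ι` (`j ∈ s`) on ONE probability space, each measurable with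
  `V^j_n ⇒ N(0, v_j)^{⊗ι}` (`v_j ≠ 0`), quantiles `q_j ≥ 0`, `ε > 0`: eventually
  `1 − Σ_{j∈s} (1 − L_R(q_j)) − ε ≤ P(⋂_{j∈s} {|t(V^j_n)| ≤ q_j})`, with
  `L_R(q) = N(0,1)^{⊗ι}{|t| ≤ q}` (K3's `(R, q)`-only form).
* **`eventually_measureReal_biInter_abs_tStat_le_ge_const`** — equal quantiles `q`: eventually
  `1 − k (1 − L_R(q)) − ε ≤ P(all k bars cover)`.

NOT CLAIMED: the sharper simultaneous level from a JOINT Gaussian limit of the `k` statistics; which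
`q_j` the engine uses; anything numerical.
-/

namespace Summit.Ventures.LatticeQCDFlow.Exactness.GeneralNCMC

open MeasureTheory ProbabilityTheory Filter Finset WithLp
open Summit.Ventures.LatticeQCDFlow.Scoring.CardConsistency
open scoped ENNReal NNReal Topology

section SimultaneousBars

/-! ## §1 Two small conversions -/

/-- `P(Eₙ) → c` in `ℝ≥0∞` with `c ≠ ∞` gives `P.real(Eₙ) → c.toReal`. -/
theorem tendsto_measureReal_of_tendsto_measure {Ω : Type*} [MeasurableSpace Ω] {P : Measure Ω}
    {E : ℕ → Set Ω} {c : ℝ≥0∞} (hc : c ≠ ∞)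
    (h : Tendsto (fun n => P (E n)) atTop (𝓝 c)) :
    Tendsto (fun n => P.real (E n)) atTop (𝓝 c.toReal) := by
  simp_rw [measureReal_def]
  exact (ENNReal.tendsto_toReal hc).comp h

variable {ι : Type*} [Fintype ι]

/-- The acceptance event `{|t(V)| ≤ q}` of a replica-`t` bar built on a measurable replica vector
`V : Ω → EuclideanSpace ℝ ι` is measurable. -/
theorem measurableSet_abs_tStat_le {Ω₀ : Type*} [MeasurableSpace Ω₀]
    {V : Ω₀ → PiLp 2 (fun _ : ι => ℝ)} (hV : Measurable V) (q : ℝ) :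
    MeasurableSet {ω | |(∑ r, V ω r) / Fintype.card ι
        / Real.sqrt ((∑ r, (V ω r - (∑ r', V ω r') / Fintype.card ι) ^ 2)
            / ((Fintype.card ι : ℝ) * (Fintype.card ι - 1)))| ≤ q} := by
  have hco : Measurable fun ω => (ofLp (V ω) : ι → ℝ) :=
    (MeasurableEquiv.toLp 2 (ι → ℝ)).symm.measurable.comp hV
  have hm := (measurable_tStat_pi (ι := ι)).comp hco
  exact measurableSet_le hm.abs measurable_const

/-! ## §2 Simultaneous coverage of several replica-`t` bars -/

variable [Nontrivial ι]

/-- **SEVERAL REPLICA-`t` BARS AT ONCE (Bonferroni).**  On one probability space, finitely many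
replica-vector statistics `V^j_n` (`j ∈ s`), each measurable and converging in distribution to
`N(0, v_j)^{⊗ι}` (`v_j ≠ 0`); quantiles `q_j ≥ 0`; `ε > 0`.  Then eventually
`1 − Σ_{j∈s} (1 − L_R(q_j)) − ε ≤ P(⋂_{j∈s} {|t(V^j_n)| ≤ q_j})` — all bars cover simultaneously with
at least that probability; no independence or joint limit of the `k` statistics is used. -/
theorem eventually_measureReal_biInter_abs_tStat_le_ge {Ω₀ : Type*} [MeasurableSpace Ω₀]
    {P : Measure Ω₀} [IsProbabilityMeasure P] {K : Type*} (s : Finset K)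
    {V : K → ℕ → Ω₀ → PiLp 2 (fun _ : ι => ℝ)} (hV : ∀ j ∈ s, ∀ n, Measurable (V j n))
    {v : K → ℝ≥0} (hv : ∀ j ∈ s, v j ≠ 0)
    (h : ∀ j ∈ s, TendstoInDistribution (V j) atTop (toLp 2) (fun _ => P)
      (Measure.pi fun _ : ι => gaussianReal 0 (v j)))
    {q : K → ℝ} (hq : ∀ j ∈ s, 0 ≤ q j) {ε : ℝ} (hε : 0 < ε) :
    ∀ᶠ n in atTop,
      1 - ∑ j ∈ s, (1 - ((Measure.pi fun _ : ι => gaussianReal 0 1) {z : ι → ℝ |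
            |(∑ r, z r) / Fintype.card ι
              / Real.sqrt ((∑ r, (z r - (∑ r', z r') / Fintype.card ι) ^ 2)
                / ((Fintype.card ι : ℝ) * (Fintype.card ι - 1)))| ≤ q j}).toReal) - ε
        ≤ P.real (⋂ j ∈ s, {ω | |(∑ r, V j n ω r) / Fintype.card ι
            / Real.sqrt ((∑ r, (V j n ω r - (∑ r', V j n ω r') / Fintype.card ι) ^ 2)
                / ((Fintype.card ι : ℝ) * (Fintype.card ι - 1)))| ≤ q j}) := by
  refine eventually_measureReal_biInter_ge s
    (E := fun j n => {ω | |(∑ r, V j n ω r) / Fintype.card ι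
        / Real.sqrt ((∑ r, (V j n ω r - (∑ r', V j n ω r') / Fintype.card ι) ^ 2)
            / ((Fintype.card ι : ℝ) * (Fintype.card ι - 1)))| ≤ q j})
    (fun j hj n => measurableSet_abs_tStat_le (hV j hj n) (q j)) (fun j hj => ?_) hε
  have ht := tendsto_measure_abs_tStat_le_of_pi_gaussianReal (hv j hj) (h j hj) (hq j hj)
  rw [pi_gaussianReal_measure_abs_tStat_le_eq (hv j hj)] at ht
  exact tendsto_measureReal_of_tendsto_measure (measure_ne_top _ _) ht

/-- **Equal quantiles**: with the same `q ≥ 0` for all `k = #s` bars, eventually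
`1 − k (1 − L_R(q)) − ε ≤ P(all bars cover)`; per-bar level `L_R(q) = 1 − α/k` gives a table valid
simultaneously with asymptotic probability `≥ 1 − α − ε`. -/
theorem eventually_measureReal_biInter_abs_tStat_le_ge_const {Ω₀ : Type*} [MeasurableSpace Ω₀]
    {P : Measure Ω₀} [IsProbabilityMeasure P] {K : Type*} (s : Finset K)
    {V : K → ℕ → Ω₀ → PiLp 2 (fun _ : ι => ℝ)} (hV : ∀ j ∈ s, ∀ n, Measurable (V j n))
    {v : K → ℝ≥0} (hv : ∀ j ∈ s, v j ≠ 0)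
    (h : ∀ j ∈ s, TendstoInDistribution (V j) atTop (toLp 2) (fun _ => P)
      (Measure.pi fun _ : ι => gaussianReal 0 (v j)))
    {q : ℝ} (hq : 0 ≤ q) {ε : ℝ} (hε : 0 < ε) :
    ∀ᶠ n in atTop,
      1 - (s.card : ℝ) * (1 - ((Measure.pi fun _ : ι => gaussianReal 0 1) {z : ι → ℝ |
            |(∑ r, z r) / Fintype.card ι
              / Real.sqrt ((∑ r, (z r - (∑ r', z r') / Fintype.card ι) ^ 2)
                / ((Fintype.card ι : ℝ) * (Fintype.card ι - 1)))| ≤ q}).toReal) - ε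
        ≤ P.real (⋂ j ∈ s, {ω | |(∑ r, V j n ω r) / Fintype.card ι
            / Real.sqrt ((∑ r, (V j n ω r - (∑ r', V j n ω r') / Fintype.card ι) ^ 2)
                / ((Fintype.card ι : ℝ) * (Fintype.card ι - 1)))| ≤ q}) := by
  have hmain := eventually_measureReal_biInter_abs_tStat_le_ge s hV hv h (q := fun _ => q)
    (fun _ _ => hq) hε
  simp only [Finset.sum_const, nsmul_eq_mul] at hmain
  exact hmain

end SimultaneousBars

end Summit.Ventures.LatticeQCDFlow.Exactness.GeneralNCMC
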